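import Summits.QuantumAdvantage.QuantumAdvantage.Theorems.MultiRingRowSquares
import Summits.QuantumAdvantage.QuantumAdvantage.Theses.ProductDial
import Summits.QuantumAdvantage.QuantumAdvantage.Theses.ExactnessDial
import Summits.QuantumAdvantage.QuantumAdvantage.Theses.FormsDichotomy
import Summits.QuantumAdvantage.QuantumAdvantage.Theses.PencilDial
import Summits.QuantumAdvantage.QuantumAdvantage.Theses.SpreadDial
import Summits.QuantumAdvantage.AdviceFreeQNC0.AdviceFreeQNC0Three
import Literature.Computability.MetaComplexity.SmolenskyRelations
import HarnessLib

/-!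
# Many-ring grid bridge, part 3/3: many-ring hardness ⇒ `HLFNotFAC0Mod p` (item stmt-QuantumAdvantage-26125 `MultiRingBridge3` PROVED)

Module 3 of the split of `MultiRingBridge` (lens-5 «BridgeDial» node, decomp-qadv cell gen 6, tree twin sha256 d782ca8a…; split into three ≤ 400-line modules for landing by the census seat decomp-qadv-census-1 g5 — content VERBATIM, only module boundaries, headers and five helper docstrings added).


Cell decomp-qadv, seat lens-5 («finite range + asymptotic regime + bridge»), generation 6, node «BridgeDial».

The FIVE born product-family routes of the rung leaf F-Q1-p3 (`AdviceFreeQNC0Three = AdviceFreeQNC0Sep 3`) — ProductDial,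
ExactnessDial, FormsDichotomy, PencilDial, SpreadDial — all consume the support item
`MultiRingBridge3 : MultiRingHard3 → HLFNotFAC0Mod 3` (stmt-QuantumAdvantage-26125) as a binder of `closes`.  It was OPEN
(the route headers' «PROVED in the ProductDial node» is an error of the cell handoff: no proof existed).  This file proves it,
for every prime `p` and from the WEAKER many-ring hypothesis in which the ring-count exponent `K` may depend on the
degree exponent `c` (`∃ θ ∀ c ∃ K n₀ …` instead of the item's `∃ K θ ∀ c ∃ n₀ …`; stated as explicit binders of
`hlfNotFAC0Mod_of_multiRing`, no new `Prop` is introduced in the tree):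

* `GridCycles N J n` — `J` pairwise vertex-disjoint cycles of length `n` embedded in the `N × N` grid; `ringsInstance Γ X` — the
  2D-HLF instance whose quadratic part is the union of the cycles' adjacency matrices and whose linear part is the pattern `X j`
  on cycle `j` (BGK 2018 §4.2 Eq. (31) for a cycle FAMILY with independent linear parts); `ringsInstance_isValid`;
  `kerCount_toFun` / `kerCount_eq_zero`; `mem_Lq_iff` (`z ∈ L_q` iff every restriction `z ∘ Γ j` lies in the ring kernel
  `K(X j)`); `rel_of_mem_hlfSolutions` (an HLF solution solves EVERY ring's relation `RingHLF.Rel (X j) (z ∘ Γ j)`);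
  `encodeHLF_ringsInstance_subst` (the input string is a projection of the joint pattern) — the single-cycle file
  `Literature/…/ShallowCircuitsRing.lean` generalised line by line.
* `GridCycles.rowSquares` — the PACKING: for `t ≥ 2` and `J(2t+1) ≤ N`, the boundaries of the `J` squares of side `2t` with
  top-left corners `(0, j(2t+1))` are `J` disjoint grid cycles of length `8t`.
* `hlfNotFAC0Mod_of_multiRing` — THE BRIDGE.  Given `AC⁰[p]` circuits for `N × N` 2D-HLF (depth `d`, size `≤ s(N)`), let
  `t` be the largest integer with `(8t)^K(2t+1) ≤ N` (`K = K(d+2)`), `n = 8t`, `J = n^K`; restrict the circuits to the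
  instances `ringsInstance (rowSquares …) X`; the relational Razborov–Smolensky lemma (tree `Smolensky.exists_uniformProb_le`,
  error charged ONCE to the whole output tuple) yields a joint pattern `X` with success probability
  `≤ θ₀ + N²(s(N)+2)/p^ℓ ≤ (1+θ₀)/2`, because a polynomial map solving HLF on `ringsInstance Γ X` wins every ring
  (`rel_of_mem_hlfSolutions`) and the many-ring hypothesis bounds the all-rings-win count; degree bookkeeping:
  `N < (2n)^{K+1}` (maximality of `t`) gives `((p−1)ℓ)^{d+1} ≤ (log₂ n)^{d+2}` for `n ≥ 2^{A^{d+1}}`, `A = 3(p−1)(K+1)(k_s+3)`.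
* Corollaries: the item closed BY NAME in all five born route files — `productDial_multiRingBridge3 :
  ProductDial.MultiRingBridge3`, `exactnessDial_multiRingBridge3`, `formsDichotomy_multiRingBridge3`,
  `pencilDial_multiRingBridge3`, `spreadDial_multiRingBridge3`; the bridge-free closers `adviceFreeQNC0Three_of_multiRingHard3`
  (T* ALONE ⇒ leaf F-Q1-p3), `productDial_closes₂ : PolyLoss3 → DPLift3 → AdviceFreeQNC0Three`, `exactnessDial_closes₄`,
  `formsDichotomy_closes₄`, `pencilDial_closes₃`, `spreadDial_closes₃` (each route's `closes` with the bridge binder discharged).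

WHAT THIS IS NOT: no lower bound for polynomial strategies is proved here (many-ring hardness stays a hypothesis); the
converse transfer (all rings won ⇒ an HLF solution) is not needed and not proved.
-/

noncomputable section

open Finset Polynomial
open Literature.Computability.Cryptography Literature.Computability.Complexity
open Literature.Computability.QuantumComplexity Literature.Computability.MetaComplexity
open Literature.Computability.QuantumComplexity.RingHLF

-- the sub-problem namespace `Summit.QuantumAdvantage.QuantumAdvantage` repeats the summit name by design (D-0017)
set_option linter.dupNamespace false

namespace Summit.QuantumAdvantage.QuantumAdvantage.Theorems

open Summit.QuantumAdvantage.AdviceFreeQNC0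

/-! ## 3. The bridge: many-ring hardness (WEAK form, ring-count exponent after the degree exponent) ⇒ `HLFNotFAC0Mod p` -/

/-- Arithmetic: `N^K ≤ 2^{(log₂ N + 1)·K}`. -/
private theorem pow_le_two_pow_log_succ_mul' (N K : ℕ) :
    N ^ K ≤ 2 ^ ((Nat.log 2 N + 1) * K) := by
  rw [pow_mul]
  exact Nat.pow_le_pow_left (Nat.lt_pow_succ_log_self one_lt_two N).le K

/-- Arithmetic: the degree bound of the many-ring bridge.  With `A = 3(p-1)(K+1)K₁`: if `log₂ N + 1 ≤ (log₂ n + 2)(K+1)`,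
`log₂ n ≥ 1` and `A^{d+1} ≤ log₂ n`, then `((p-1)(log₂ N + 1)K₁)^{d+1} ≤ (log₂ n)^{d+2}`. -/
private theorem degree_boundW {p K K₁ L Ln d : ℕ}
    (hL : L + 1 ≤ (Ln + 2) * (K + 1)) (hLn : 1 ≤ Ln)
    (hA : (3 * (p - 1) * (K + 1) * K₁) ^ (d + 1) ≤ Ln) :
    ((p - 1) * ((L + 1) * K₁)) ^ (d + 1) ≤ Ln ^ (d + 2) := by
  have h1 : (p - 1) * ((L + 1) * K₁) ≤ (3 * (p - 1) * (K + 1) * K₁) * Ln := by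
    have h2 : (L + 1) * K₁ ≤ (Ln + 2) * (K + 1) * K₁ := Nat.mul_le_mul_right _ hL
    have h3 : (Ln + 2) * (K + 1) * K₁ ≤ (3 * Ln) * (K + 1) * K₁ :=
      Nat.mul_le_mul_right _ (Nat.mul_le_mul_right _ (by omega))
    calc (p - 1) * ((L + 1) * K₁) ≤ (p - 1) * ((3 * Ln) * (K + 1) * K₁) :=
          Nat.mul_le_mul_left _ (h2.trans h3)
      _ = (3 * (p - 1) * (K + 1) * K₁) * Ln := by ring
  calc ((p - 1) * ((L + 1) * K₁)) ^ (d + 1) ≤ ((3 * (p - 1) * (K + 1) * K₁) * Ln) ^ (d + 1) :=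
        Nat.pow_le_pow_left h1 _
    _ = (3 * (p - 1) * (K + 1) * K₁) ^ (d + 1) * Ln ^ (d + 1) := by rw [mul_pow]
    _ ≤ Ln * Ln ^ (d + 1) := Nat.mul_le_mul_right _ hA
    _ = Ln ^ (d + 2) := by ring

/-- Arithmetic: the error term (as in `RingFrameBridge`).  For `N ≥ 1`, `s(N) ≤ c N^k + c` and `(2c+2) ≤ δ N`:
`N²(s(N)+2)/D ≤ δ` whenever `N^{k+3} ≤ D`. -/
private theorem error_bound' {N k c : ℕ} {sN D δ : ℝ} (hN : 1 ≤ N) (hs : sN ≤ c * (N : ℝ) ^ k + c)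
    (hδ : (2 * c + 2 : ℝ) ≤ δ * N) (hD : ((N : ℝ)) ^ (k + 3) ≤ D) (hDpos : 0 < D) :
    (N : ℝ) * N * (sN + 2) / D ≤ δ := by
  have hN' : (1 : ℝ) ≤ N := by exact_mod_cast hN
  have hNk : (1 : ℝ) ≤ (N : ℝ) ^ k := one_le_pow₀ hN'
  rw [div_le_iff₀ hDpos]
  have h1 : sN + 2 ≤ (2 * c + 2) * (N : ℝ) ^ k := by nlinarith
  have h2 : (N : ℝ) * N * (sN + 2) ≤ (N : ℝ) * N * ((2 * c + 2) * (N : ℝ) ^ k) := by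
    have : (0 : ℝ) ≤ (N : ℝ) * N := by positivity
    exact mul_le_mul_of_nonneg_left h1 this
  calc (N : ℝ) * N * (sN + 2) ≤ (N : ℝ) * N * ((2 * c + 2) * (N : ℝ) ^ k) := h2
    _ = (2 * c + 2) * (N : ℝ) ^ (k + 2) := by ring
    _ ≤ δ * N * (N : ℝ) ^ (k + 2) := by
        have : (0 : ℝ) ≤ (N : ℝ) ^ (k + 2) := by positivity
        exact mul_le_mul_of_nonneg_right hδ this
    _ = δ * (N : ℝ) ^ (k + 3) := by ring
    _ ≤ δ * D := by
        have hδ0 : 0 ≤ δ := by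
          have : (0 : ℝ) < 2 * c + 2 := by positivity
          nlinarith
        exact mul_le_mul_of_nonneg_left hD hδ0

/-- **THE MANY-RING GRID BRIDGE** (hypotheses = the WEAK many-ring hardness `∃ θ₀ < 1, ∀ c, ∃ K n₀, …`: for every degree
exponent `c` some ring-count exponent `K` and threshold `n₀` such that every joint `𝔽_p`-strategy of degree `≤ (log₂ n)^c`
for `n^K` disjoint `n`-rings wins all rings on `≤ θ₀·2^{n^K·n}` joint patterns; the tree's `ProductDial.MultiRingHard3`
= `∃ K θ ∀ c ∃ n₀ …` is the special case `p = 3`, `K` uniform in `c`).  Restrict `N × N` 2D-HLF circuits over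
`accBasis p` to the many-ring instances `ringsInstance (rowSquares N (n^K) t) X` (`n = 8t`, `t` maximal with
`n^K(2t+1) ≤ N`), turn the `FAC⁰[p]` circuit tuple into ONE joint low-degree `𝔽_p`-strategy for all `n^K` rings by the
relational Razborov–Smolensky lemma (tree `Smolensky.exists_uniformProb_le`; the error `N²(s(N)+2)/p^ℓ` is charged once to the
whole tuple), and transfer HLF solutions to all-rings wins (`GridCycles.rel_of_mem_hlfSolutions`).  Threshold obtained:
`(1 + θ₀)/2` from the many-ring threshold `θ₀`. -/
theorem hlfNotFAC0Mod_of_multiRing (p : ℕ) [Fact p.Prime] {θ₀ : ℝ} (hθ₀ : θ₀ < 1)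
    (hhard : ∀ c : ℕ, ∃ K n₀ : ℕ, ∀ n ≥ n₀,
      ∀ P : Fin (n ^ K) → Fin n → Smolensky.CubeFn (ZMod p) (n ^ K * n),
        (∀ j i, P j i ∈ Smolensky.lowDeg (ZMod p) (n ^ K * n) ((Nat.log 2 n) ^ c)) →
          ((Finset.univ.filter fun X : Fin (n ^ K) → Fin n → Bool => ∀ j, RingHLF.Rel (X j)
            (fun i => decide (P j i (fun k => X (finProdFinEquiv.symm k).1 (finProdFinEquiv.symm k).2) = 1))).card : ℝ)
            ≤ θ₀ * (2 : ℝ) ^ (n ^ K * n)) :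
    HLFNotFAC0Mod p := by
  classical
  have hp := (Fact.out : p.Prime)
  set δ : ℝ := (1 - θ₀) / 2 with hδ
  have hδpos : 0 < δ := by rw [hδ]; linarith
  refine ⟨θ₀ + δ, by rw [hδ]; linarith, fun d s => ?_⟩
  -- size bound `s(N) ≤ cs N^ks + cs`
  obtain ⟨cs, ks, hcs⟩ := exists_eval_le_mul_pow_add s
  -- many-ring hardness at degree exponent `d + 2`: ring-count exponent `K`, length threshold `n₀`
  obtain ⟨K, n₀, hn₀⟩ := hhard (d + 2)
  -- the constants
  set K₁ : ℕ := ks + 3 with hK₁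
  set A : ℕ := 3 * (p - 1) * (K + 1) * K₁ with hA
  set M : ℕ := ⌈1 / δ⌉₊ with hM
  set t₀ : ℕ := max (max 2 n₀) (2 ^ (A ^ (d + 1))) with ht₀
  have ht₀2 : 2 ≤ t₀ := le_trans (le_max_left _ _) (le_max_left _ _)
  have ht₀n₀ : n₀ ≤ t₀ := le_trans (le_max_right _ _) (le_max_left _ _)
  have ht₀A : 2 ^ (A ^ (d + 1)) ≤ t₀ := le_max_right _ _
  refine ⟨max ((8 * t₀) ^ K * (2 * t₀ + 1)) (max 5 (M * (2 * cs + 2))), fun N hN r Cs hover hdep hsize => ?_⟩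
  have hNt₀ : (8 * t₀) ^ K * (2 * t₀ + 1) ≤ N := le_trans (le_max_left _ _) hN
  have hN5 : 5 ≤ N := le_trans (le_max_left _ _) (le_trans (le_max_right _ _) hN)
  have hNM : M * (2 * cs + 2) ≤ N := le_trans (le_max_right _ _) (le_trans (le_max_right _ _) hN)
  have hN0 : N ≠ 0 := by omega
  -- the maximal admissible half-side `t`
  set t : ℕ := Nat.findGreatest (fun t => (8 * t) ^ K * (2 * t + 1) ≤ N) N with ht
  have ht₀N : t₀ ≤ N := by
    have h1 : 1 ≤ (8 * t₀) ^ K := Nat.one_le_pow _ _ (by omega)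
    have h2 : 2 * t₀ + 1 ≤ (8 * t₀) ^ K * (2 * t₀ + 1) := Nat.le_mul_of_pos_left _ h1
    omega
  have ht₀t : t₀ ≤ t := Nat.le_findGreatest ht₀N hNt₀
  have hPt : (8 * t) ^ K * (2 * t + 1) ≤ N :=
    Nat.findGreatest_spec (P := fun t => (8 * t) ^ K * (2 * t + 1) ≤ N) ht₀N hNt₀
  have ht2 : 2 ≤ t := ht₀2.trans ht₀t
  have hn3 : 3 ≤ 8 * t := by omega
  have htn₀ : n₀ ≤ 8 * t := by omega
  have htA : 2 ^ (A ^ (d + 1)) ≤ 8 * t := by omega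
  have hJ0 : 0 < (8 * t) ^ K := Nat.pos_of_ne_zero (by positivity)
  -- maximality: `N < (8(t+1))^K (2t+3)`
  have ht1N : t + 1 ≤ N := by
    have h1 : 1 ≤ (8 * t) ^ K := Nat.one_le_pow _ _ (by omega)
    have h2 : 2 * t + 1 ≤ (8 * t) ^ K * (2 * t + 1) := Nat.le_mul_of_pos_left _ h1
    omega
  have hnot : ¬ ((8 * (t + 1)) ^ K * (2 * (t + 1) + 1) ≤ N) :=
    Nat.findGreatest_is_greatest (P := fun t => (8 * t) ^ K * (2 * t + 1) ≤ N) (by rw [ht]; exact Nat.lt_succ_self _) ht1N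
  -- the packing: `(8t)^K` disjoint `8t`-cycles
  let Γ : GridCycles N ((8 * t) ^ K) (8 * t) := GridCycles.rowSquares N ((8 * t) ^ K) t ht2 hJ0 hPt
  -- the Razborov–Smolensky parameter
  set L : ℕ := Nat.log 2 N with hL
  set Ln : ℕ := Nat.log 2 (8 * t) with hLn
  set ℓ : ℕ := (L + 1) * K₁ with hℓ
  have hℓ1 : 1 ≤ ℓ := by rw [hℓ, hK₁]; nlinarith
  -- `log₂ N + 1 ≤ (log₂ (8t) + 2)(K + 1)` from the maximality of `t`
  have hL1 : L + 1 ≤ (Ln + 2) * (K + 1) := by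
    have h16 : (8 * (t + 1)) ^ K * (2 * (t + 1) + 1) ≤ (16 * t) ^ (K + 1) := by
      rw [pow_succ]
      exact Nat.mul_le_mul (Nat.pow_le_pow_left (by omega) K) (by omega)
    have h8 : 8 * t < 2 ^ (Ln + 1) := Nat.lt_pow_succ_log_self one_lt_two (8 * t)
    have h2Ln : 16 * t ≤ 2 ^ (Ln + 2) := by
      have : 2 ^ (Ln + 2) = 2 * 2 ^ (Ln + 1) := by ring
      omega
    have hNlt : N < 2 ^ ((Ln + 2) * (K + 1)) :=
      calc N < (8 * (t + 1)) ^ K * (2 * (t + 1) + 1) := Nat.lt_of_not_le hnot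
        _ ≤ (16 * t) ^ (K + 1) := h16
        _ ≤ (2 ^ (Ln + 2)) ^ (K + 1) := Nat.pow_le_pow_left h2Ln _
        _ = 2 ^ ((Ln + 2) * (K + 1)) := by rw [← pow_mul]
    exact Nat.succ_le_of_lt ((Nat.log_lt_iff_lt_pow one_lt_two hN0).2 hNlt)
  have hLn1 : 1 ≤ Ln := by
    rw [hLn]
    exact Nat.le_log_of_pow_le one_lt_two (by omega)
  have hALn : A ^ (d + 1) ≤ Ln := by
    rw [hLn]
    exact Nat.le_log_of_pow_le one_lt_two htA
  -- degree: `((p-1)ℓ)^{d+1} ≤ (log₂ (8t))^{d+2}`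
  have hdeg : ((p - 1) * ℓ) ^ (d + 1) ≤ (Nat.log 2 (8 * t)) ^ (d + 2) := by
    rw [hℓ, ← hLn]
    exact degree_boundW hL1 hLn1 (by rw [← hA]; exact hALn)
  -- the polynomial-map bound from the many-ring hypothesis at ring length `8t`, `(8t)^K` rings
  have hB : ∀ P : Fin (N * N) → Smolensky.CubeFn (ZMod p) ((8 * t) ^ K * (8 * t)),
      (∀ v, P v ∈ Smolensky.lowDeg (ZMod p) ((8 * t) ^ K * (8 * t)) (((p - 1) * ℓ) ^ (d + 1))) →
        ((univ.filter fun u : Fin ((8 * t) ^ K * (8 * t)) → Bool =>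
            (fun w => (fun v => decide (P v u = 1)) (finProdFinEquiv w)) ∈
              hlfSolutions (Γ.ringsInstance (unflat u))).card : ℝ) ≤ θ₀ * (2 : ℝ) ^ ((8 * t) ^ K * (8 * t)) := by
    intro P hP
    -- the ring outputs of `P`
    let Q : Fin ((8 * t) ^ K) → Fin (8 * t) → Smolensky.CubeFn (ZMod p) ((8 * t) ^ K * (8 * t)) :=
      fun j i => P (finProdFinEquiv (Γ.toFun j i))
    have hQ : ∀ j i, Q j i ∈ Smolensky.lowDeg (ZMod p) ((8 * t) ^ K * (8 * t)) ((Nat.log 2 (8 * t)) ^ (d + 2)) :=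
      fun j i => Smolensky.lowDeg_mono hdeg (hP _)
    have hring := hn₀ (8 * t) htn₀ Q hQ
    refine le_trans ?_ hring
    have hsub : (univ.filter fun u : Fin ((8 * t) ^ K * (8 * t)) → Bool =>
        (fun w => (fun v => decide (P v u = 1)) (finProdFinEquiv w)) ∈
          hlfSolutions (Γ.ringsInstance (unflat u))).card ≤
        (univ.filter fun X : Fin ((8 * t) ^ K) → Fin (8 * t) → Bool => ∀ j, RingHLF.Rel (X j)
          (fun i => decide (Q j i (fun k => X (finProdFinEquiv.symm k).1 (finProdFinEquiv.symm k).2) = 1))).card := by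
      refine Finset.card_le_card_of_injOn unflat (fun u hu => ?_) (unflat_injective.injOn)
      simp only [coe_filter, mem_univ, true_and, Set.mem_setOf_eq] at hu ⊢
      intro j
      have hfu : (fun k => unflat u (finProdFinEquiv.symm k).1 (finProdFinEquiv.symm k).2) = u := flat_unflat u
      rw [hfu]
      exact GridCycles.rel_of_mem_hlfSolutions hn3 (unflat u) hu j
    exact_mod_cast hsub
  -- the relational Razborov–Smolensky lemma, charged once to the whole output tuple
  obtain ⟨u, hu⟩ := Smolensky.exists_uniformProb_le hℓ1
    (fun u : Fin ((8 * t) ^ K * (8 * t)) → Bool => encodeHLF (Γ.ringsInstance (unflat u)))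
    (fun c => by
      rcases GridCycles.encodeHLF_ringsInstance_subst Γ c with ⟨b, hb⟩ | ⟨j, i, hji⟩
      · exact Or.inl ⟨b, fun u => hb _⟩
      · exact Or.inr ⟨finProdFinEquiv (j, i), fun u => by rw [hji]; rfl⟩)
    (fun j : Fin (N * N) => Cs (finProdFinEquiv.symm j))
    (fun j => hover _) (fun j => hdep _)
    (fun u z => (fun v => z (finProdFinEquiv v)) ∈ hlfSolutions (Γ.ringsInstance (unflat u))) hB
  refine ⟨Γ.ringsInstance (unflat u), GridCycles.ringsInstance_isValid _, ?_⟩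
  simp only [Equiv.symm_apply_apply] at hu
  refine hu.trans ?_
  -- the two error terms
  have h2t : (2 : ℝ) ^ ((8 * t) ^ K * (8 * t)) ≠ 0 := pow_ne_zero _ two_ne_zero
  rw [mul_div_assoc, div_self h2t, mul_one]
  refine add_le_add le_rfl ?_
  -- `Σ_j (size + 2) ≤ N²(s N + 2)` and `p^ℓ ≥ N^{ks+3}`
  have hpℓpos : (0 : ℝ) < (p : ℝ) ^ ℓ := by
    have : (0 : ℝ) < p := by exact_mod_cast hp.pos
    positivity
  have hsum : (∑ j : Fin (N * N), (((Cs (finProdFinEquiv.symm j)).size : ℝ) + 2)) ≤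
      (N : ℝ) * N * (((s.eval N : ℕ) : ℝ) + 2) := by
    calc (∑ j : Fin (N * N), (((Cs (finProdFinEquiv.symm j)).size : ℝ) + 2))
        ≤ ∑ _j : Fin (N * N), (((s.eval N : ℕ) : ℝ) + 2) :=
          sum_le_sum fun j _ => by
            have := hsize (finProdFinEquiv.symm j)
            exact add_le_add (by exact_mod_cast this) le_rfl
      _ = (N : ℝ) * N * (((s.eval N : ℕ) : ℝ) + 2) := by
          rw [sum_const, card_univ, Fintype.card_fin, nsmul_eq_mul]
          push_cast
          ring
  have hD : ((N : ℝ)) ^ (ks + 3) ≤ (p : ℝ) ^ ℓ := by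
    have h1 : N ^ (ks + 3) ≤ 2 ^ ℓ := by
      rw [hℓ, hK₁, hL]
      exact pow_le_two_pow_log_succ_mul' N (ks + 3)
    have h2 : 2 ^ ℓ ≤ p ^ ℓ := Nat.pow_le_pow_left hp.two_le ℓ
    exact_mod_cast h1.trans h2
  have hMδ : (2 * cs + 2 : ℝ) ≤ δ * N := by
    have hM1 : (1 : ℝ) / δ ≤ M := by rw [hM]; exact Nat.le_ceil _
    have hMN : ((M * (2 * cs + 2) : ℕ) : ℝ) ≤ N := by exact_mod_cast hNM
    push_cast at hMN
    have hMδ' : 1 ≤ δ * (M : ℝ) := by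
      rw [div_le_iff₀ hδpos] at hM1
      linarith
    have h0 : (0 : ℝ) ≤ 2 * cs + 2 := by positivity
    calc (2 * cs + 2 : ℝ) = 1 * (2 * cs + 2) := by ring
      _ ≤ δ * (M : ℝ) * (2 * cs + 2) := mul_le_mul_of_nonneg_right hMδ' h0
      _ = δ * ((M : ℝ) * (2 * cs + 2)) := by ring
      _ ≤ δ * N := mul_le_mul_of_nonneg_left hMN hδpos.le
  calc (∑ j : Fin (N * N), (((Cs (finProdFinEquiv.symm j)).size : ℝ) + 2)) / (p : ℝ) ^ ℓ
      ≤ (N : ℝ) * N * (((s.eval N : ℕ) : ℝ) + 2) / (p : ℝ) ^ ℓ :=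
        div_le_div_of_nonneg_right hsum hpℓpos.le
    _ ≤ δ := error_bound' (k := ks) (c := cs) (by omega) (by exact_mod_cast hcs N) hMδ hD hpℓpos

/-! ## 4. The route items closed by name (`p = 3`) and the bridge-free closers -/

/-- **Item stmt-QuantumAdvantage-26125 `ProductDial.MultiRingBridge3` PROVED**: `MultiRingHard3 → HLFNotFAC0Mod 3`. -/
theorem productDial_multiRingBridge3 : Theses.ProductDial.MultiRingBridge3 := by
  rintro ⟨K, θ, hθ, hh⟩
  exact hlfNotFAC0Mod_of_multiRing 3 hθ fun c => ⟨K, hh c⟩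

/-- The verbatim copy of the item in route ExactnessDial, proved. -/
theorem exactnessDial_multiRingBridge3 : Theses.ExactnessDial.MultiRingBridge3 := by
  rintro ⟨K, θ, hθ, hh⟩
  exact hlfNotFAC0Mod_of_multiRing 3 hθ fun c => ⟨K, hh c⟩

/-- The verbatim copy of the item in route FormsDichotomy, proved. -/
theorem formsDichotomy_multiRingBridge3 : Theses.FormsDichotomy.MultiRingBridge3 := by
  rintro ⟨K, θ, hθ, hh⟩
  exact hlfNotFAC0Mod_of_multiRing 3 hθ fun c => ⟨K, hh c⟩

/-- The verbatim copy of the item in route PencilDial, proved. -/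
theorem pencilDial_multiRingBridge3 : Theses.PencilDial.MultiRingBridge3 := by
  rintro ⟨K, θ, hθ, hh⟩
  exact hlfNotFAC0Mod_of_multiRing 3 hθ fun c => ⟨K, hh c⟩

/-- The verbatim copy of the item in route SpreadDial, proved. -/
theorem spreadDial_multiRingBridge3 : Theses.SpreadDial.MultiRingBridge3 := by
  rintro ⟨K, θ, hθ, hh⟩
  exact hlfNotFAC0Mod_of_multiRing 3 hθ fun c => ⟨K, hh c⟩

/-- **T\* alone gives the leaf**: `MultiRingHard3 → AdviceFreeQNC0Three` (stmt-26122 ⇒ F-Q1-p3, no bridge hypothesis). -/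
theorem adviceFreeQNC0Three_of_multiRingHard3 (h : Theses.ProductDial.MultiRingHard3) :
    Summit.QuantumAdvantage.AdviceFreeQNC0.AdviceFreeQNC0Three :=
  (adviceFreeQNC0Three_iff).mpr (adviceFreeQNC0Sep_of_hlfNotFAC0Mod 3 (productDial_multiRingBridge3 h))

/-- **ProductDial's `closes` with the bridge binder DISCHARGED**: `PolyLoss3 → DPLift3 → AdviceFreeQNC0Three`. -/
theorem productDial_closes₂ (hP : Theses.ProductDial.PolyLoss3) (hD : Theses.ProductDial.DPLift3) :
    Summit.QuantumAdvantage.AdviceFreeQNC0.AdviceFreeQNC0Three :=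
  Theses.ProductDial.closes hP hD productDial_multiRingBridge3

/-- ExactnessDial's `closes` with the bridge binder discharged. -/
theorem exactnessDial_closes₄ (hN : Theses.ExactnessDial.NoPerfectOdd3) (hM : Theses.ExactnessDial.MassStep3u)
    (hO : Theses.ExactnessDial.OddToAll3) (hD : Theses.ExactnessDial.DPLift3) :
    Summit.QuantumAdvantage.AdviceFreeQNC0.AdviceFreeQNC0Three :=
  Theses.ExactnessDial.closes hN hM hO hD exactnessDial_multiRingBridge3

/-- FormsDichotomy's `closes` with the bridge binder discharged. -/
theorem formsDichotomy_closes₄ (hL : Theses.FormsDichotomy.FewFormsPolyLoss3)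
    (hH : Theses.FormsDichotomy.FarFewFormsPolyLoss3) (hG : Theses.FormsDichotomy.FormsSplitGlue3)
    (hD : Theses.FormsDichotomy.DPLift3) :
    Summit.QuantumAdvantage.AdviceFreeQNC0.AdviceFreeQNC0Three :=
  Theses.FormsDichotomy.closes hL hH hG hD formsDichotomy_multiRingBridge3

/-- PencilDial's `closes` with the bridge binder discharged. -/
theorem pencilDial_closes₃ (hP : Theses.PencilDial.PolyLoss3) (hG : Theses.PencilDial.GlobalPencilHard3)
    (hL : Theses.PencilDial.GlobalPencilLift3) :
    Summit.QuantumAdvantage.AdviceFreeQNC0.AdviceFreeQNC0Three :=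
  Theses.PencilDial.closes hP hG hL pencilDial_multiRingBridge3

/-- SpreadDial's `closes` with the bridge binder discharged. -/
theorem spreadDial_closes₃ (hP : Theses.SpreadDial.PolyLoss3) (hC : Theses.SpreadDial.CoverLift3)
    (hH : Theses.SpreadDial.SpreadBridge3) :
    Summit.QuantumAdvantage.AdviceFreeQNC0.AdviceFreeQNC0Three :=
  Theses.SpreadDial.closes hP hC hH spreadDial_multiRingBridge3

end Summit.QuantumAdvantage.QuantumAdvantage.Theorems
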